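import Literature.MathematicalPhysics.QuantumFieldTheory.Balaban1983to89.B1Ineq226RegionChain

/-!
# `Balaban1983to89.B1Ineq226RegularRegion` — [Balaban1982Higgs1] Prop. 2.1 (2.26) p. 610–611, THE `δG_k(Ω, Ω₀, A)` CLAUSE, VALUE AND
# DERIVATIVE MEMBERS, FOR BIG-BLOCK REGIONS `Ω ⊆ Ω₀ ⊂ T_ε` UNDER `R₀` AT EVERY (2.23)-REGULAR FIELD ON THE (Higgs)₂,₃ CARRIER =
# [Balaban1983RegularityDecay] Theorem p. 573 (1.11)–(1.12) with (1.10), carrier instance for regions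

statement-level skeleton of published theorems with citation tags; proofs where landed; nothing here is a claim about the Yang–Mills mass gap

PDF held: `paper:balaban1982-cmp85-higgs23-i` pp. 610–611 [PDF 8–9]; `paper:balaban1983-cmp89-regularity-decay` pp. 573, 578–579 [PDF 3, 8–9];
p. 579 read on the ×2 render `pub-balaban/b2b-balaban-ref1/pages/1983-cmp89-regularity-decay/…-p009-x2.png`.

CITATION HEADER (lean-in-tree rule).  T. Bałaban, *(Higgs)₂,₃ quantum fields in a finite volume. I. A lower bound*, Commun. Math. Phys. **85**
(1982) 603–626 [Balaban1982Higgs1] (Prop. 2.1 (2.23), (2.25), (2.26) pp. 610–611) and T. Bałaban, *Regularity and decay of lattice Green's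
functions*, Commun. Math. Phys. **89** (1983) 571–597 [Balaban1983RegularityDecay] (Theorem p. 573 (1.10)–(1.12); proof p. 579).  Cell `lit-balaban`
(HOME `run/shared/lean/pub/lit-balaban/`), Phase-2 proof seat **p35** gen 13 (unit `lit-balaban-p35`); SKELETON rows **B1.Prop2.1** / **B1.Eq2.26**
(REGIONS of `T_ε`, concrete carrier, every (2.23)-regular `A`) and **B4.Thm@573** ((1.11)–(1.12), carrier model instance).  USED BY NAME, never
restated: this lineage's `B1Ineq226RegionChain.chain_region_diff_of_inputs_probe` (the printed cancellation of the two walk expansions, general probe),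
`B1Ineq225RegularRegion` (`abs_acT_sub_le_of_reg_on`, `lpT_two_le_of_blockK`, `bOp_of_good`, `Gloc_of_good`, `rS_le_real`, `blockPiece`,
`sum_blockPiece`), `B1Ineq225DerivRegularRegion` (`cube_deriv_sup`, `covDeriv_add'`, `covDeriv_zero'`, `covDeriv_sum'`, `norm_covDeriv_tail_le`,
`exists_le_of_geometric`), `B1TorusRegionRop.norm_GP_RopP_pow_apply_le`, `B1TorusCubeLpInput.cube_inputs_lp`, `B1Lemma21RegularRegion.sNorm_bOp_le_of_bad`,
r14's `tdist_shift_le_one`, `tdist_blockIter_le_real`, `sum_exp_neg_tdist_le`.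

WHAT IS PRINTED.  [B1] p. 610–611: *«Similarly we have |(D^η_{A,μ}G_k(Ω, A)f)(x)|, |(G_k(Ω, A)f)(x)| ≤ c₀exp(−δ₀dist(x, supp f))‖f‖_∞ (2.25) for
x ∈ Ω, dist(x, Ω^c) ≥ R₀. If Ω ⊂ Ω₀, then for δG_k(Ω, Ω₀, A) defined by the equality δG_k(Ω, Ω₀, A) = G_k(Ω, A) − G_k(Ω₀, A), (2.26) we have
the inequalities (2.24), (2.25) with the additional factor exp(−δ₀ dist(supp f, Ω^c) − δ₀ dist({x, x′}, Ω^c)) on the right sides.»*  [B4] p. 579: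
*«We estimate the terms of the representation as above and we get the first inequality in (2.22) with 2^{d+1} instead of 2^d and with the
restriction n ≥ … ≥ (2M)⁻¹(dist({x, x′}, supp f) + dist({x, x′}, Ω^c) + dist(supp f, Ω^c)) − 3. It implies all the inequalities we need.»*

WHAT THIS FILE PROVES (kernel-checked, zero `sorry`; theorems only, no definition, no `Prop` fact).
* §1 small tools: `exists_sum_le_of_geometric` (the joint remainder of the two expansions), `covDeriv_sub'`, `covDeriv_eq_zero_of_vanish`.
* §2 **`deltaG_region_reg_decay`** — THE `δG` CLAUSE (2.26) WITH (2.25), VALUE AND DERIVATIVE MEMBERS, FOR BIG-BLOCK REGIONS `Ω ⊆ Ω₀ ⊂ T_ε`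
  UNDER `R₀` AT EVERY FIELD (2.23)-REGULAR ON `Ω₀`: for `d ≥ 1`, `L ≥ 2`, `a > 0`, `m² > 0`, `N`, `(e, q)`, a mesh cap `ε₀`, a regularity pair
  `c ≥ 0`, `β > 0`: constants `c₀ > 0`, `K₀min`, and for every `K₀ ≥ K₀min` a threshold `e₁ > 0` such that on every torus of the carrier with
  `K₀ ∣ M`, at every level `1 ≤ K ≤ K_P` with `3·L^KK₀ ≤ |T_ε|_μ`, `L^Kε ≤ ε₀`, for all big-block unions `Ω ⊆ Ω₀`, every `A` and `0 < e_K ≤ e₁` with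
  (2.23) on `Ω₀`, every `x` with `{|y − x| ≤ 2rS + 2M(d+1) + 1} ⊂ Ω`, every `g` supported in a `K`-block with `‖g‖_∞ ≤ M′` vanishing within `D` of
  `x`, `x` at distance `≥ D₀` and `supp g` at distance `≥ D₁` from `Ω^c` (`D, D₀, D₁ ≥ 0` real):
  `‖(G^ε_K(Ω, A)1_Ωg − G^ε_K(Ω₀, A)1_{Ω₀}g)(x)‖ ≤ c₀(L^Kε)²·exp(−(D + D₀ + D₁)/(4K₀L^K))·M′` and, for every `μ`,
  `‖(D^ε_A(G^ε_K(Ω, A)1_Ωg − G^ε_K(Ω₀, A)1_{Ω₀}g))(⟨x, μ⟩)‖ ≤ c₀(L^Kε)·exp(−(D + D₀ + D₁)/(4K₀L^K))·M′`.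
* §3 → the sibling module `B1Ineq226RegularRegionSum` (p331605): **`deltaG_region_reg_decay_sum`** — the same two members for ARBITRARY `g`
  (summation over the `K`-blocks as in this lineage's (2.25) files, rate `1/(8K₀L^K)`); this file ends with §2 (v1.1 doc-only pointer fix,
  r02 g24 reading note 2026-08-22T14:59Z; no declaration changed).
HONEST SCOPE.  (i) Value and derivative members of the `δG` clause in the operator form of gens 10–12 (the Hölder member (2.24)-with-factor is a
separate row); (ii) (2.23) is assumed on `Ω₀` (it implies (2.23) on `Ω`); (iii) `R₀` in site form with respect to `Ω`; decay rate `1/(4K₀)` per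
`L^Kε` in the three distances (half this lineage's (2.25) rate, as printed: `(2M)⁻¹` versus `M⁻¹`), `1/(8K₀)` after the block summation;
constants not optimised; (iv) `Ω ⊆ Ω₀` big-block unions of one torus `T_ε`; `m² > 0`.  Unit `lit-balaban-p35` gen 13
(literature-prover-lit-balaban-p35-g13-0); v1.1 doc-only gen 14 (literature-prover-lit-balaban-p35-g14-0).
-/

open scoped BigOperators

noncomputable section

namespace Literature.MathematicalPhysics.QuantumFieldTheory.Balaban1983to89.B1Ineq226RegularRegion

open Literature.MathematicalPhysics.QuantumFieldTheory.Balaban1983to89.HiggsLattice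
open Literature.MathematicalPhysics.QuantumFieldTheory.Balaban1983to89.HiggsAveraging
open Literature.MathematicalPhysics.QuantumFieldTheory.Balaban1983to89.HiggsCovariance
open Literature.MathematicalPhysics.QuantumFieldTheory.Balaban1983to89.HiggsCovariancePos
open Literature.MathematicalPhysics.QuantumFieldTheory.Balaban1983to89.HiggsCovarianceCont (sNorm sNorm_nonneg sNorm_smul)
open Literature.MathematicalPhysics.QuantumFieldTheory.Balaban1983to89.B1TorusCubeCover
open Literature.MathematicalPhysics.QuantumFieldTheory.Balaban1983to89.B1TorusCubeLocality26 (rS cubeVec rS_succ_lt_half)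
open Literature.MathematicalPhysics.QuantumFieldTheory.Balaban1983to89.B1TorusCubeChart (dd castD toT M2 predL_succ)
open Literature.MathematicalPhysics.QuantumFieldTheory.Balaban1983to89.B1TorusCubeBoxOp (acT cube_inputs)
open Literature.MathematicalPhysics.QuantumFieldTheory.Balaban1983to89.B4Lower18Regular (e1)
open Literature.MathematicalPhysics.QuantumFieldTheory.Balaban1983to89.B4Lemma22EtaBox (vol vol_pos)
open Literature.MathematicalPhysics.QuantumFieldTheory.Balaban1983to89.B4PartitionUnity22 (hprof D1 D2 D1_nonneg D2_nonneg contDiff_hprof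
  hasCompactSupport_hprof)
open Literature.MathematicalPhysics.QuantumFieldTheory.Balaban1983to89.B1TorusRegionCubes
open Literature.MathematicalPhysics.QuantumFieldTheory.Balaban1983to89.B1TorusRegionHSizes (IsBigBlockUnion blockSat_of_isBigBlockUnion)
open Literature.MathematicalPhysics.QuantumFieldTheory.Balaban1983to89.B1TorusRegionRop
open Literature.MathematicalPhysics.QuantumFieldTheory.Balaban1983to89.B1TorusLabelWalk
open Literature.MathematicalPhysics.QuantumFieldTheory.Balaban1983to89.B1Lemma21RegularRegion (sNorm_bOp_le_of_bad)
open Literature.MathematicalPhysics.QuantumFieldTheory.Balaban1983to89.B1TorusCubeLpInput (lpT lpT_def lpT_nonneg cube_inputs_lp)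
open Literature.MathematicalPhysics.QuantumFieldTheory.Balaban1983to89.B1Ineq225RegionChain
open Literature.MathematicalPhysics.QuantumFieldTheory.Balaban1983to89.B1Ineq225RegularRegion
open Literature.MathematicalPhysics.QuantumFieldTheory.Balaban1983to89.B1Ineq225DerivRegularRegion
open Literature.MathematicalPhysics.QuantumFieldTheory.Balaban1983to89.B1Ineq226RegionChain
open Literature.MathematicalPhysics.QuantumFieldTheory.Balaban1983to89.B1Ineq234LevelZero (tdist_triangle_real tdist_shift_le_one tdist_comm)
open Literature.MathematicalPhysics.QuantumFieldTheory.Balaban1983to89.B1Ineq234Concrete (tdist_blockIter_le_real)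
open Literature.MathematicalPhysics.QuantumFieldTheory.Balaban1983to89.B1Ineq18RegularRegion (gammaReg_pos)
open Literature.MathematicalPhysics.QuantumFieldTheory.Balaban1983to89.B2Restr216Lattice (norm_U_apply)
open Literature.MathematicalPhysics.QuantumFieldTheory.Balaban1983to89.B2Eq230CondShiftBound (sum_exp_neg_tdist_le)
open Literature.MathematicalPhysics.QuantumFieldTheory.Balaban1983to89.B4Sect5Proof (latticeConst latticeConst_nonneg)

variable {P : HiggsLattice.Params} {N : ℕ}

/-! ## §1 Small tools: the joint remainder, the derivative probe on differences -/

section Tools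

/-- The joint remainder of the two expansions: two geometric tail bounds with the same ratio give a common index `m` with
`Φ₁(m) + Φ₂(m) ≤ ε′` — the hypothesis `hrem` of `B1Ineq226RegionChain.chain_region_diff_of_inputs_probe`.
[cite: Balaban1983RegularityDecay, (2.12) p.577, p.579 «we take the representations (2.13) for both propagators»] -/
theorem exists_sum_le_of_geometric {Φ₁ Φ₂ : ℕ → ℝ} {ρ C₁ C₂ : ℝ} (hρ0 : 0 ≤ ρ) (hρ : ρ < 1) (hC₁ : 0 ≤ C₁) (hC₂ : 0 ≤ C₂)
    (h₁ : ∀ m, Φ₁ m ≤ ρ ^ m * C₁) (h₂ : ∀ m, Φ₂ m ≤ ρ ^ m * C₂) (ε' : ℝ) (hε' : 0 < ε') :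
    ∃ m : ℕ, Φ₁ m + Φ₂ m ≤ ε' :=
  exists_le_of_geometric (Φ := fun m => Φ₁ m + Φ₂ m) hρ0 hρ (add_nonneg hC₁ hC₂)
    (fun m => by have e : ρ ^ m * (C₁ + C₂) = ρ ^ m * C₁ + ρ ^ m * C₂ := by ring
                 rw [e]; exact add_le_add (h₁ m) (h₂ m)) ε' hε'

variable (C : ChargeData N) (A : HiggsLattice.VecField P 0)

/-- `D^ε_A(u − v) = D^ε_Au − D^ε_Av`. [cite: Balaban1982Higgs1, (1.7) p.605] -/
theorem covDeriv_sub' (u v : HiggsLattice.ScalarField P 0 N) (b : HiggsLattice.PBond P 0) :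
    covDeriv C A (u - v) b = covDeriv C A u b - covDeriv C A v b := by
  unfold covDeriv
  rw [Pi.sub_apply, Pi.sub_apply, map_sub, ← smul_sub]
  congr 1
  abel

/-- The derivative probe is local: `D^ε_Aw(⟨x, μ⟩) = 0` when `w(x) = w(x + e_μ) = 0`. [cite: Balaban1982Higgs1, (1.7) p.605] -/
theorem covDeriv_eq_zero_of_vanish (w : HiggsLattice.ScalarField P 0 N) {x : HiggsLattice.Site P 0} {μ : Fin P.d} (h1 : w x = 0)
    (h2 : w (x.shift μ) = 0) : covDeriv C A w ⟨x, μ⟩ = 0 := by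
  have ht : w ((⟨x, μ⟩ : HiggsLattice.PBond P 0).tgt) = 0 := h2
  have hs : w ((⟨x, μ⟩ : HiggsLattice.PBond P 0).src) = 0 := h1
  unfold covDeriv
  rw [ht, hs, map_zero, sub_zero, smul_zero]

end Tools

/-! ## §2 The `δG` clause, value and derivative members, for big-block regions `Ω ⊆ Ω₀` at every (2.23)-regular field -/

section Main

set_option maxHeartbeats 1600000 in
/-- **PROP. 2.1 (2.26) WITH (2.25), VALUE AND DERIVATIVE MEMBERS, FOR BIG-BLOCK REGIONS `Ω ⊆ Ω₀ ⊂ T_ε` UNDER `R₀`, AT EVERY VECTOR FIELD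
(2.23)-REGULAR ON `Ω₀` — B4's THEOREM (1.11)–(1.12) WITH (1.10) FOR REGIONS ON THE CARRIER.**  For `d ≥ 1`, `L ≥ 2`, `a > 0`, `m² > 0`, `N`, `(e, q)`,
a mesh cap `ε₀` and a regularity pair `c ≥ 0`, `β > 0`: constants `c₀ > 0`, `K₀min`, and for every cube size `K₀ ≥ K₀min` a threshold `e₁ > 0` such
that on EVERY torus of the carrier with `K₀ ∣ M`, at every level `1 ≤ K ≤ K_P` with `3·L^KK₀ ≤ |T_ε|_μ` and `L^Kε ≤ ε₀`, for ALL big-block unions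
`Ω ⊆ Ω₀`, EVERY vector field `A` and `0 < e_K ≤ e₁` with (2.23) ON `Ω₀` (`(L^Kε|e|/e_K)|A_ν(z + εe_μ) − A_ν(z)| ≤ c·e_K^{β−1}/L^K`, `z ∈ Ω₀`),
every site `x` with `{y : |y − x| ≤ 2rS + 2M(d + 1) + 1} ⊂ Ω` (the `R₀` restriction), every `g` supported in a `K`-block with `‖g‖_∞ ≤ M′`
vanishing at the sites within lattice distance `< D` of `x`, `x` at distance `≥ D₀` from `Ω^c` and `supp g` at distance `≥ D₁` from `Ω^c`:
`‖(G^ε_K(Ω, A)1_Ωg − G^ε_K(Ω₀, A)1_{Ω₀}g)(x)‖ ≤ c₀(L^Kε)²·exp(−(D + D₀ + D₁)/(4K₀L^K))·M′` AND, for every direction `μ`,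
`‖(D^ε_A(G^ε_K(Ω, A)1_Ωg − G^ε_K(Ω₀, A)1_{Ω₀}g))(⟨x, μ⟩)‖ ≤ c₀(L^Kε)·exp(−(D + D₀ + D₁)/(4K₀L^K))·M′`.
Proof = `chain_region_diff_of_inputs_probe` with the evaluation probe (`X₀ = {x}`) and the derivative probe (`X₀ = {x, x + e_μ}`), letters at the
interior cubes of `Ω` from `cube_inputs_lp`/`cube_deriv_sup` under (2.23) read through the chart, `L²` letters at every piece of `Ω` and of `Ω₀` from
Lemma 2.1 (`sNorm_bOp_le_of_bad`), `V = 1` on a `K`-block, both remainders geometric.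
[cite: Balaban1982Higgs1, Prop. 2.1 (2.23), (2.25), (2.26) pp.610–611] [cite: Balaban1983RegularityDecay, Theorem (1.10)–(1.12) p.573; proof p.579] -/
theorem deltaG_region_reg_decay (d L : ℕ) (hd : 1 ≤ d) (hL : 2 ≤ L) {a : ℝ} (ha : 0 < a) {msq : ℝ} (hmsq : 0 < msq)
    (N : ℕ) (C : ChargeData N) (ε₀ : ℝ) (creg β : ℝ) (hcreg : 0 ≤ creg) (hβ : 0 < β) :
    ∃ c₀ : ℝ, 0 < c₀ ∧ ∃ K₀min : ℕ, ∀ K₀ : ℕ, K₀min ≤ K₀ → ∃ e₁ : ℝ, 0 < e₁ ∧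
      ∀ (P : HiggsLattice.Params), P.d = d → P.L = L → K₀ ∣ P.M →
      ∀ {K : ℕ}, 1 ≤ K → K ≤ P.K → (∀ μ, 3 * half P K K₀ ≤ P.sitesPerDir 0 μ) → P.mesh K ≤ ε₀ →
      ∀ (Ω Ω₀ : Finset (HiggsLattice.Site P 0)), IsBigBlockUnion K K₀ Ω → IsBigBlockUnion K K₀ Ω₀ → Ω ⊆ Ω₀ →
      ∀ (A : HiggsLattice.VecField P 0) {ec : ℝ}, 0 < ec → ec ≤ e₁ →
      (∀ z ∈ Ω₀, ∀ μ ν : Fin P.d,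
          P.mesh K * |C.e| / ec * |A ⟨z.shift μ, ν⟩ - A ⟨z, ν⟩| ≤ creg * ec ^ (β - 1) / (P.L : ℝ) ^ K) →
      ∀ (x : HiggsLattice.Site P 0),
        (∀ y, HiggsLattice.Site.tdist x y ≤ 2 * rS P K K₀ + 2 * half P K K₀ * (P.d + 1) + 1 → y ∈ Ω) →
        ∀ (y₀ : HiggsLattice.Site P 0) (g : HiggsLattice.ScalarField P 0 N) (M D D₀ D₁ : ℝ),
          (∀ y, blockIter K y ≠ blockIter K y₀ → g y = 0) → (∀ y, ‖g y‖ ≤ M) → 0 ≤ D → 0 ≤ D₀ → 0 ≤ D₁ →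
          (∀ z, g z ≠ 0 → D ≤ (HiggsLattice.Site.tdist x z : ℝ)) →
          (∀ z, z ∉ Ω → D₀ ≤ (HiggsLattice.Site.tdist x z : ℝ)) →
          (∀ y z, g y ≠ 0 → z ∉ Ω → D₁ ≤ (HiggsLattice.Site.tdist z y : ℝ)) →
            ‖(propagatorK C Ω A msq a K (chi Ω • g) - propagatorK C Ω₀ A msq a K (chi Ω₀ • g)) x‖
                ≤ c₀ * P.mesh K ^ 2 * Real.exp (-((D + D₀ + D₁) / (4 * K₀ * (P.L : ℝ) ^ K))) * M ∧
            ∀ μ : Fin P.d,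
              ‖covDeriv C A (propagatorK C Ω A msq a K (chi Ω • g) - propagatorK C Ω₀ A msq a K (chi Ω₀ • g)) ⟨x, μ⟩‖
                ≤ c₀ * P.mesh K * Real.exp (-((D + D₀ + D₁) / (4 * K₀ * (P.L : ℝ) ^ K))) * M := by
  have hℓ0 : 1 ≤ L - 1 := by omega
  have hp₁ : (((d - 1 : ℕ)) : ℝ) + 1 < 2 * d := by
    rw [Nat.cast_sub hd, Nat.cast_one]
    have : (1 : ℝ) ≤ d := by exact_mod_cast hd
    linarith
  obtain ⟨Cγ, Cβ, hCγ, hCβ, hcube⟩ := cube_inputs_lp C (d - 1) (L - 1) hℓ0 a a (msq * ε₀ ^ 2) ha hp₁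
  obtain ⟨Cγ', Cδ, CT, hCγ', hCδ, hCT, hderiv⟩ := cube_deriv_sup C (d - 1) (L - 1) hℓ0 ha hmsq (msq * ε₀ ^ 2) creg β hcreg hβ
  -- the boundary-piece constant of Lemma 2.1 (depends on `d, L, a` only)
  have hLr : (1 : ℝ) < L := by exact_mod_cast (show 1 < L by omega)
  set γ₀ : ℝ := min 2 (a * (1 - (((L : ℕ) : ℝ) ^ 2)⁻¹) / 4) with hγ₀
  have hγ₀pos : 0 < γ₀ := by
    have h1 : (((L : ℕ) : ℝ) ^ 2)⁻¹ < 1 := inv_lt_one_of_one_lt₀ (by nlinarith)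
    exact lt_min (by norm_num) (by nlinarith [mul_pos ha (show (0 : ℝ) < 1 - (((L : ℕ) : ℝ) ^ 2)⁻¹ by linarith)])
  set Cb : ℝ := ((((d - 1 : ℕ)) : ℝ) + 1) * (D1 hprof + D2 hprof) * (γ₀⁻¹ + 2 * Real.sqrt (d * γ₀⁻¹) + a * γ₀⁻¹) with hCb
  have hD1 := D1_nonneg contDiff_hprof hasCompactSupport_hprof
  have hD2 := D2_nonneg contDiff_hprof hasCompactSupport_hprof
  have hCb0 : 0 ≤ Cb := by
    have := inv_nonneg.2 hγ₀pos.le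
    have := Real.sqrt_nonneg (d * γ₀⁻¹)
    positivity
  set Cm : ℝ := max Cβ Cb with hCm
  have hCm0 : 0 < Cm := lt_of_lt_of_le hCβ (le_max_left _ _)
  refine ⟨4 * (2 * 2 ^ d) * (Cγ + CT) * Real.exp 3, by positivity, max 8 ⌈(3 : ℝ) ^ d * Cm * Real.exp 1⌉₊, fun K₀ hK₀ => ?_⟩
  have hK₀8 : 8 ≤ K₀ := le_trans (le_max_left _ _) hK₀
  have hK₀r : (0 : ℝ) < K₀ := by exact_mod_cast lt_of_lt_of_le (by norm_num) hK₀8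
  have hK₀C : (3 : ℝ) ^ d * Cm * Real.exp 1 ≤ K₀ :=
    (Nat.le_ceil _).trans (by exact_mod_cast le_trans (le_max_right _ _) hK₀)
  obtain ⟨e₁, he₁, hcubeK⟩ := hcube creg β hcreg hβ K₀ hK₀8
  obtain ⟨e₃, he₃, hderK⟩ := hderiv K₀ hK₀8
  -- the smallness of `e_K` for Lemma 2.1 at the boundary pieces: `d²·c·e_K^β ≤ 1/3`
  set es : ℝ := ((3 * ((d : ℝ) ^ 2 * creg + 1))⁻¹) ^ β⁻¹ with hes
  have hin : 0 < (3 * ((d : ℝ) ^ 2 * creg + 1))⁻¹ := by positivity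
  have hes0 : 0 < es := Real.rpow_pos_of_pos hin _
  refine ⟨min (min e₁ es) e₃, lt_min (lt_min he₁ hes0) he₃, ?_⟩
  intro P hPd hPL hK₀M K hK1 hK hN3 hε Ω Ω₀ hΩ hΩ₀ hsub A ec hec hle' hreg x hR' y₀ g M D D₀ D₁ hg hgM hD0 hD₀0 hD₁0 hD hxD₀ hgD₁
  have hle : ec ≤ min e₁ es := hle'.trans (min_le_left _ _)
  have hle3 : ec ≤ e₃ := hle'.trans (min_le_right _ _)
  subst hPd
  have hdd : dd P = P.d - 1 := rfl
  have hPL1 : P.L - 1 = L - 1 := by rw [hPL]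
  have hL1 : 1 < P.L := by rw [hPL]; omega
  have hL1r : (1 : ℝ) < P.L := by exact_mod_cast hL1
  have hak : 0 ≤ B1.aSeq a P.L K := (B1.aSeq_pos ha hL1r hK1).le
  have hK₀' : 1 ≤ K₀ := le_trans (by norm_num) hK₀8
  have hmesh : 0 < P.mesh K := P.mesh_pos K
  have hcap : msq * P.mesh K ^ 2 ≤ msq * ε₀ ^ 2 := mul_le_mul_of_nonneg_left (pow_le_pow_left₀ hmesh.le hε 2) hmsq.le
  have hM0 : 0 ≤ M := (norm_nonneg _).trans (hgM x)
  have hgn : ‖g‖ ≤ M := (pi_norm_le_iff_of_nonneg hM0).2 hgM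
  -- the letter constant and its smallness
  set βK : ℝ := Cm / K₀ with hβK
  have hβK0 : 0 ≤ βK := div_nonneg hCm0.le hK₀r.le
  have hCβK : Cβ / K₀ ≤ βK := div_le_div_of_nonneg_right (le_max_left _ _) hK₀r.le
  have hCbK : Cb / K₀ ≤ βK := div_le_div_of_nonneg_right (le_max_right _ _) hK₀r.le
  have hDβ : (3 : ℝ) ^ P.d * βK ≤ Real.exp (-1) := by
    rw [hβK, mul_div_assoc', div_le_iff₀ hK₀r]
    have h1 : Real.exp (-1) * Real.exp 1 = 1 := by rw [← Real.exp_add]; norm_num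
    have h2 : (3 : ℝ) ^ P.d * Cm = (3 : ℝ) ^ P.d * Cm * Real.exp 1 * Real.exp (-1) := by
      rw [mul_assoc ((3 : ℝ) ^ P.d * Cm), mul_comm (Real.exp 1), h1, mul_one]
    rw [h2]
    exact mul_le_mul_of_nonneg_right hK₀C (Real.exp_pos _).le |>.trans_eq (mul_comm _ _)
  have h23 : (2 : ℝ) ^ P.d * βK < 1 := by
    have h1 : (2 : ℝ) ^ P.d ≤ 3 ^ P.d := pow_le_pow_left₀ (by norm_num) (by norm_num) _
    have h2 : Real.exp (-1) < 1 := Real.exp_lt_one_iff.2 (by norm_num)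
    nlinarith [mul_le_mul_of_nonneg_right h1 hβK0]
  -- the cube inputs at the interior cubes of `Ω` (which lie in `Ω₀`, where (2.23) holds)
  have hcj : ∀ j : Lab P K K₀, cube K K₀ j ⊆ Ω → _ := fun j hj =>
    hcubeK P hdd hPL1 K hK1 hK hK₀M hN3 a msq le_rfl le_rfl hmsq hcap j A ec hec (hle.trans (min_le_left _ _))
      (abs_acT_sub_le_of_reg_on hK hK₀M hK₀' C j A hec fun z hz μ ν => hreg z (hsub (hj hz)) μ ν)
  have hdj : ∀ j : Lab P K K₀, cube K K₀ j ⊆ Ω → _ := fun j hj =>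
    hderK P hdd hPL1 hK1 hK hK₀M hN3 hcap j A hec hle3 fun z hz μ' ν => hreg z (hsub (hj hz)) μ' ν
  -- the smallness `d²·c·e_K^β ≤ 1/3`
  have hsmall : (P.d : ℝ) ^ 2 * creg * ec ^ β ≤ 1 / 3 := by
    have h1 : ec ^ β ≤ es ^ β := Real.rpow_le_rpow hec.le (hle.trans (min_le_right _ _)) hβ.le
    have h2 : es ^ β = (3 * ((P.d : ℝ) ^ 2 * creg + 1))⁻¹ := by rw [hes, Real.rpow_inv_rpow hin.le hβ.ne']
    rw [h2] at h1
    have h3 : (P.d : ℝ) ^ 2 * creg * ec ^ β ≤ (P.d : ℝ) ^ 2 * creg * (3 * ((P.d : ℝ) ^ 2 * creg + 1))⁻¹ :=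
      mul_le_mul_of_nonneg_left h1 (by positivity)
    refine h3.trans ?_
    rw [← div_eq_mul_inv, div_le_div_iff₀ (by positivity) (by norm_num)]
    nlinarith [sq_nonneg (P.d : ℝ), mul_nonneg (sq_nonneg (P.d : ℝ)) hcreg]
  -- the `L²` letter at every piece of a big-block region carrying (2.23) (Lemma 2.1 at the boundary pieces, (2.21) at the interior cubes)
  have h2gen : ∀ (Ω' : Finset (HiggsLattice.Site P 0)), IsBigBlockUnion K K₀ Ω' → Ω' ⊆ Ω₀ →
      ∀ (j : Lab P K K₀) (ψ : HiggsLattice.ScalarField P 0 N), (∀ y, y ∉ Ω' → ψ y = 0) →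
        sNorm (bOp C K K₀ Ω' A msq a j ψ) ≤ βK * sNorm ψ := by
    intro Ω' hΩ' hsub' j ψ hψ
    have hreg' : ∀ z ∈ Ω', ∀ μ ν : Fin P.d,
        P.mesh K * |C.e| / ec * |A ⟨z.shift ν, μ⟩ - A ⟨z, μ⟩| ≤ creg * ec ^ (β - 1) / (P.L : ℝ) ^ K :=
      fun z hz μ ν => hreg z (hsub' hz) ν μ
    by_cases hj : cube K K₀ j ⊆ Ω'
    · -- interior cube: the (2, 2) letter of (2.21), transferred to the (1.5) norm
      have hcj' := hcubeK P hdd hPL1 K hK1 hK hK₀M hN3 a msq le_rfl le_rfl hmsq hcap j A ec hec (hle.trans (min_le_left _ _))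
        (abs_acT_sub_le_of_reg_on hK hK₀M hK₀' C j A hec fun z hz μ ν => hreg z (hsub' (hj hz)) μ ν)
      have h22 := hcj'.2.2.1 2 2 (by norm_num) le_rfl (by rw [sub_self]; positivity) ψ
      have hc := cTwo_pos P K
      rw [lpT_two_eq, lpT_two_eq, mul_left_comm (Cβ / (K₀ : ℝ))] at h22
      have h3 := le_of_mul_le_mul_left h22 hc
      rw [bOp_of_good C Ω' A msq a hj ψ, ← neg_one_smul ℝ, sNorm_smul, abs_neg, abs_one, one_mul]
      exact h3.trans (mul_le_mul_of_nonneg_right hCβK (sNorm_nonneg _))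
    · -- boundary piece: Lemma 2.1
      have hb := sNorm_bOp_le_of_bad C ha hL1 hmsq hK1 hK hK₀M hK₀8 hN3 hΩ' A hec hreg' hsmall hj ψ hψ
      refine hb.trans (mul_le_mul_of_nonneg_right (le_trans (le_of_eq ?_) hCbK) (sNorm_nonneg _))
      rw [hCb, hγ₀, hPL, hdd]
  have h2Ω := h2gen Ω hΩ hsub
  have h2Ω₀ := h2gen Ω₀ hΩ₀ subset_rfl
  -- the interior letters of the `Ω`-system, as the chain wants them
  have hGsup : ∀ i : Lab P K K₀, cube K K₀ i ⊆ Ω → ∀ ψ : HiggsLattice.ScalarField P 0 N,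
      ‖Gloc C K K₀ Ω A msq a i (hTor K K₀ i • ψ)‖ ≤ Cγ * P.mesh K ^ 2 * ‖ψ‖ := fun i hi ψ => by
    rw [Gloc_of_good C Ω A msq a hi]; exact (hcj i hi).1 ψ
  have hb0 : ∀ j : Lab P K K₀, cube K K₀ j ⊆ Ω → ∀ ψ : HiggsLattice.ScalarField P 0 N, ‖bOp C K K₀ Ω A msq a j ψ‖ ≤ βK * ‖ψ‖ :=
    fun j hj ψ => by
      rw [bOp_of_good C Ω A msq a hj ψ, norm_neg]
      exact ((hcj j hj).2.1 ψ).trans (mul_le_mul_of_nonneg_right hCβK (norm_nonneg _))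
  have hbgr : ∀ j : Lab P K K₀, cube K K₀ j ⊆ Ω → ∀ p q : ℝ, 1 ≤ p → p ≤ q → p⁻¹ - q⁻¹ ≤ (2 * P.d : ℝ)⁻¹ →
      ∀ ψ : HiggsLattice.ScalarField P 0 N, lpT K q (bOp C K K₀ Ω A msq a j ψ) ≤ βK * lpT K p ψ :=
    fun j hj p q h1p hpq hdiff ψ => by
      rw [bOp_of_good C Ω A msq a hj ψ, lpT_neg]
      exact ((hcj j hj).2.2.1 p q h1p hpq hdiff ψ).trans (mul_le_mul_of_nonneg_right hCβK (lpT_nonneg _ _))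
  have hbps : ∀ j : Lab P K K₀, cube K K₀ j ⊆ Ω → ∀ ψ : HiggsLattice.ScalarField P 0 N,
      ‖bOp C K K₀ Ω A msq a j ψ‖ ≤ βK * lpT K (2 * P.d) ψ := fun j hj ψ => by
    rw [bOp_of_good C Ω A msq a hj ψ, norm_neg]
    exact ((hcj j hj).2.2.2 (2 * P.d) le_rfl ψ).trans (mul_le_mul_of_nonneg_right hCβK (lpT_nonneg _ _))
  -- common geometry
  have hh : (half P K K₀ : ℝ) = (P.L : ℝ) ^ K * K₀ := by unfold half; push_cast; ring
  have hhpos : (0 : ℝ) < half P K K₀ := by exact_mod_cast half_pos hK₀'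
  have hh1 : (1 : ℝ) ≤ half P K K₀ := by exact_mod_cast half_pos hK₀'
  have hrS := rS_le_real (P := P) (K := K) hK₀8
  have hV1 : lpT K 2 g ≤ 1 * ‖g‖ := by rw [one_mul]; exact lpT_two_le_of_blockK hK y₀ hg
  -- the remainder constants
  have hsq : 0 < Real.sqrt (P.mesh 0 ^ P.d) := Real.sqrt_pos.2 (pow_pos (P.mesh_pos 0) _)
  have hCval : 0 ≤ (Real.sqrt (P.mesh 0 ^ P.d))⁻¹ * msq⁻¹ * sNorm g := by
    have := sNorm_nonneg g
    positivity
  have hCder : 0 ≤ (P.mesh 0)⁻¹ * (2 * ((Real.sqrt (P.mesh 0 ^ P.d))⁻¹ * msq⁻¹ * sNorm g)) := by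
    have := sNorm_nonneg g
    have := P.mesh_pos 0
    positivity
  have hremV : ∀ (Ω' : Finset (HiggsLattice.Site P 0)),
      (∀ (j : Lab P K K₀) (ψ : HiggsLattice.ScalarField P 0 N), (∀ y, y ∉ Ω' → ψ y = 0) →
        sNorm (bOp C K K₀ Ω' A msq a j ψ) ≤ βK * sNorm ψ) →
      ∀ m : ℕ, ‖(GP C K Ω' A msq a * RopP C K K₀ Ω' A msq a ^ m) g x‖
        ≤ (2 ^ P.d * βK) ^ m * ((Real.sqrt (P.mesh 0 ^ P.d))⁻¹ * msq⁻¹ * sNorm g) := fun Ω' h2' m =>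
    (norm_GP_RopP_pow_apply_le C Ω' A hK hK₀M hK₀8 hmsq hak hβK0 h2' m g x).trans (le_of_eq (by ring))
  -- the three-distance exponent bookkeeping: a numerator `≥ D + D₀ + D₁ − 2` costs at most `e³`
  have hexp : ∀ {S : ℕ}, D + D₀ + D₁ - 2 ≤ (S : ℝ) →
      Real.exp (-(((S : ℝ) - 8 * rS P K K₀ - 4 * half P K K₀) / (4 * half P K K₀)))
        ≤ Real.exp 3 * Real.exp (-((D + D₀ + D₁) / (4 * K₀ * (P.L : ℝ) ^ K))) := by
    intro S hS
    rw [← Real.exp_add]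
    refine Real.exp_le_exp.2 ?_
    have e1 : (D + D₀ + D₁) / (4 * K₀ * (P.L : ℝ) ^ K) = (D + D₀ + D₁) / (4 * half P K K₀) := by rw [hh]; ring_nf
    rw [e1]
    have e2 : ((S : ℝ) - 8 * rS P K K₀ - 4 * half P K K₀) / (4 * half P K K₀) - (D + D₀ + D₁) / (4 * half P K K₀)
        = ((S : ℝ) - (D + D₀ + D₁) - 8 * rS P K K₀ - 4 * half P K K₀) / (4 * half P K K₀) := by ring
    have h5 : -(3 : ℝ) ≤ ((S : ℝ) - (D + D₀ + D₁) - 8 * rS P K K₀ - 4 * half P K K₀) / (4 * half P K K₀) := by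
      rw [le_div_iff₀ (by positivity)]
      nlinarith
    linarith
  have hceil : ∀ {t : ℝ}, t ≤ (⌈t⌉₊ : ℝ) := fun {t} => Nat.le_ceil t
  have hceil1 : ∀ {t : ℝ}, t - 1 ≤ (((⌈t⌉₊ - 1 : ℕ)) : ℝ) := by
    intro t
    have ht : t ≤ (⌈t⌉₊ : ℝ) := Nat.le_ceil t
    rcases Nat.eq_zero_or_pos ⌈t⌉₊ with h0 | hpos
    · rw [h0]; simp; linarith [show (⌈t⌉₊ : ℝ) = 0 by exact_mod_cast h0]
    · rw [Nat.cast_sub hpos, Nat.cast_one]; linarith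
  refine ⟨?_, fun μ => ?_⟩
  · ------------------------------------------------------------------ the value member: `Φ(w) = ‖w(x)‖`, `X₀ = {x}`
    have hR : ∀ x' ∈ ({x} : Finset (HiggsLattice.Site P 0)), ∀ y,
        HiggsLattice.Site.tdist x' y ≤ 2 * rS P K K₀ + 2 * half P K K₀ * (P.d + 1) → y ∈ Ω := by
      intro x' hx' y hy
      rw [Finset.mem_singleton] at hx'
      subst hx'
      exact hR' y (by omega)
    have hmain := chain_region_diff_of_inputs_probe C Ω Ω₀ A hK hK₀M hK₀8 hN3 hΩ hΩ₀ hsub hmsq hak (n₀ := P.d) P.hd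
      (γ := Cγ * P.mesh K ^ 2) (β := βK) (by positivity) hβK0 hDβ
      (Φ := fun w : HiggsLattice.ScalarField P 0 N => ‖w x‖) (by simp) (fun u v => norm_add_le (u x) (v x))
      (fun u v => norm_sub_le (u x) (v x)) ({x} : Finset (HiggsLattice.Site P 0))
      (fun w hw => by rw [hw x (Finset.mem_singleton_self x), norm_zero])
      (fun i hi g' => aOp_apply_norm_le C Ω A msq a hK hK₀M hK₀8 i (hGsup i hi) g' x)
      hb0 hbgr hbps h2Ω h2Ω₀ hR g (Dist := ⌈D⌉₊) (D₀ := ⌈D₀⌉₊) (D₁ := ⌈D₁⌉₊)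
      (fun x' hx' y hy => by
        rw [Finset.mem_singleton] at hx'; subst hx'
        exact Nat.ceil_le.2 (hD y hy))
      (fun x' hx' z hz => by
        rw [Finset.mem_singleton] at hx'; subst hx'
        exact Nat.ceil_le.2 (hxD₀ z hz))
      (fun y hy z hz => Nat.ceil_le.2 (hgD₁ y z hy hz))
      (V := 1) le_rfl hV1
      (exists_sum_le_of_geometric (by positivity) h23 hCval hCval (hremV Ω h2Ω) (hremV Ω₀ h2Ω₀))
    refine hmain.trans ?_
    have hS : D + D₀ + D₁ - 2 ≤ (((⌈D⌉₊ + ⌈D₀⌉₊ + ⌈D₁⌉₊ : ℕ)) : ℝ) := by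
      push_cast
      linarith [hceil (t := D), hceil (t := D₀), hceil (t := D₁)]
    have hex := hexp hS
    have hcard : (({x} : Finset (HiggsLattice.Site P 0)).card : ℝ) = 1 := by rw [Finset.card_singleton]; simp
    rw [hcard, one_mul]
    calc 4 * (2 : ℝ) ^ P.d * (Cγ * P.mesh K ^ 2) * 1
          * Real.exp (-(((((⌈D⌉₊ + ⌈D₀⌉₊ + ⌈D₁⌉₊ : ℕ)) : ℝ) - 8 * rS P K K₀ - 4 * half P K K₀) / (4 * half P K K₀))) * ‖g‖
        ≤ 4 * (2 : ℝ) ^ P.d * (Cγ * P.mesh K ^ 2) * 1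
          * (Real.exp 3 * Real.exp (-((D + D₀ + D₁) / (4 * K₀ * (P.L : ℝ) ^ K)))) * M :=
          mul_le_mul (mul_le_mul_of_nonneg_left hex (by positivity)) hgn (norm_nonneg _) (by positivity)
      _ ≤ 4 * (2 * 2 ^ P.d) * ((Cγ + CT) * P.mesh K ^ 2) * 1
          * (Real.exp 3 * Real.exp (-((D + D₀ + D₁) / (4 * K₀ * (P.L : ℝ) ^ K)))) * M := by
          have h1 : (2 : ℝ) ^ P.d ≤ 2 * 2 ^ P.d := by linarith [pow_pos (show (0 : ℝ) < 2 by norm_num) P.d]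
          have h2 : Cγ * P.mesh K ^ 2 ≤ (Cγ + CT) * P.mesh K ^ 2 := mul_le_mul_of_nonneg_right (by linarith) (by positivity)
          gcongr
      _ = 4 * (2 * 2 ^ P.d) * (Cγ + CT) * Real.exp 3 * P.mesh K ^ 2 * Real.exp (-((D + D₀ + D₁) / (4 * K₀ * (P.L : ℝ) ^ K))) * M := by
          ring
  · ------------------------------------------------------------------ the derivative member: `Φ(w) = ‖D^ε_Aw(⟨x, μ⟩)‖`, `X₀ = {x, x + e_μ}`
    have hR : ∀ x' ∈ ({x, x.shift μ} : Finset (HiggsLattice.Site P 0)), ∀ y,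
        HiggsLattice.Site.tdist x' y ≤ 2 * rS P K K₀ + 2 * half P K K₀ * (P.d + 1) → y ∈ Ω := by
      intro x' hx' y hy
      simp only [Finset.mem_insert, Finset.mem_singleton] at hx'
      rcases hx' with h | h
      · subst h; exact hR' y (by omega)
      · subst h
        apply hR' y
        have h1 := tdist_shift_le_one x μ
        have h2 : (HiggsLattice.Site.tdist x y : ℝ) ≤ HiggsLattice.Site.tdist x (x.shift μ) + HiggsLattice.Site.tdist (x.shift μ) y :=
          tdist_triangle_real _ _ _
        have h3 : HiggsLattice.Site.tdist x y ≤ HiggsLattice.Site.tdist x (x.shift μ) + HiggsLattice.Site.tdist (x.shift μ) y := by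
          exact_mod_cast h2
        omega
    -- distances from the shifted end point lose at most one lattice step
    have hshift : ∀ {t : ℝ} {y : HiggsLattice.Site P 0}, t ≤ (HiggsLattice.Site.tdist x y : ℝ) →
        ⌈t⌉₊ - 1 ≤ HiggsLattice.Site.tdist (x.shift μ) y := by
      intro t y hty
      have hDy : ⌈t⌉₊ ≤ HiggsLattice.Site.tdist x y := Nat.ceil_le.2 hty
      have h1 := tdist_shift_le_one x μ
      have h2 : (HiggsLattice.Site.tdist x y : ℝ) ≤ HiggsLattice.Site.tdist x (x.shift μ) + HiggsLattice.Site.tdist (x.shift μ) y :=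
        tdist_triangle_real _ _ _
      have h3 : HiggsLattice.Site.tdist x y ≤ HiggsLattice.Site.tdist x (x.shift μ) + HiggsLattice.Site.tdist (x.shift μ) y := by
        exact_mod_cast h2
      omega
    have hmain := chain_region_diff_of_inputs_probe C Ω Ω₀ A hK hK₀M hK₀8 hN3 hΩ hΩ₀ hsub hmsq hak (n₀ := P.d) P.hd
      (γ := CT * P.mesh K) (β := βK) (by positivity) hβK0 hDβ
      (Φ := fun w : HiggsLattice.ScalarField P 0 N => ‖covDeriv C A w ⟨x, μ⟩‖) (by simp [covDeriv_zero'])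
      (fun u v => by simp only [covDeriv_add']; exact norm_add_le _ _)
      (fun u v => by simp only [covDeriv_sub']; exact norm_sub_le _ _)
      ({x, x.shift μ} : Finset (HiggsLattice.Site P 0))
      (fun w hw => by
        rw [covDeriv_eq_zero_of_vanish C A w (hw x (by simp)) (hw (x.shift μ) (by simp)), norm_zero])
      (fun i hi g' => by
        show ‖covDeriv C A (aOp C K K₀ Ω A msq a i g') ⟨x, μ⟩‖ ≤ CT * P.mesh K * ‖g'‖
        rw [aOp_apply, Gloc_of_good C Ω A msq a hi]
        exact (norm_le_pi_norm (fun b => covDeriv C A (hTor K K₀ i • propagatorK C (cube K K₀ i) (cubeVec K K₀ i A) msq a K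
          (hTor K K₀ i • g')) b : HiggsLattice.PBond P 0 → EuclideanSpace ℝ (Fin N)) ⟨x, μ⟩).trans ((hdj i hi).2.2 g'))
      hb0 hbgr hbps h2Ω h2Ω₀ hR g (Dist := ⌈D⌉₊ - 1) (D₀ := ⌈D₀⌉₊ - 1) (D₁ := ⌈D₁⌉₊)
      (fun x' hx' y hy => by
        simp only [Finset.mem_insert, Finset.mem_singleton] at hx'
        rcases hx' with h | h
        · subst h; have := Nat.ceil_le.2 (hD y hy); omega
        · subst h; exact hshift (hD y hy))
      (fun x' hx' z hz => by
        simp only [Finset.mem_insert, Finset.mem_singleton] at hx'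
        rcases hx' with h | h
        · subst h; have := Nat.ceil_le.2 (hxD₀ z hz); omega
        · subst h; exact hshift (hxD₀ z hz))
      (fun y hy z hz => Nat.ceil_le.2 (hgD₁ y z hy hz))
      (V := 1) le_rfl hV1
      (exists_sum_le_of_geometric (by positivity) h23 hCder hCder
        (norm_covDeriv_tail_le C Ω A hK hK₀M hK₀8 hmsq hak hβK0 h2Ω · g ⟨x, μ⟩)
        (norm_covDeriv_tail_le C Ω₀ A hK hK₀M hK₀8 hmsq hak hβK0 h2Ω₀ · g ⟨x, μ⟩))
    refine hmain.trans ?_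
    have hS : D + D₀ + D₁ - 2 ≤ ((((⌈D⌉₊ - 1) + (⌈D₀⌉₊ - 1) + ⌈D₁⌉₊ : ℕ)) : ℝ) := by
      push_cast
      linarith [hceil1 (t := D), hceil1 (t := D₀), hceil (t := D₁)]
    have hex := hexp hS
    have hcard : (({x, x.shift μ} : Finset (HiggsLattice.Site P 0)).card : ℝ) ≤ 2 := by
      exact_mod_cast (Finset.card_insert_le _ _).trans (by rw [Finset.card_singleton])
    calc 4 * ((({x, x.shift μ} : Finset (HiggsLattice.Site P 0)).card : ℝ) * 2 ^ P.d) * (CT * P.mesh K) * 1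
          * Real.exp (-((((((⌈D⌉₊ - 1) + (⌈D₀⌉₊ - 1) + ⌈D₁⌉₊ : ℕ)) : ℝ) - 8 * rS P K K₀ - 4 * half P K K₀) / (4 * half P K K₀))) * ‖g‖
        ≤ 4 * (2 * 2 ^ P.d) * (CT * P.mesh K) * 1 * (Real.exp 3 * Real.exp (-((D + D₀ + D₁) / (4 * K₀ * (P.L : ℝ) ^ K)))) * M := by
          refine mul_le_mul (mul_le_mul ?_ hex (by positivity) (by positivity)) hgn (norm_nonneg _) (by positivity)
          have h1 : ((({x, x.shift μ} : Finset (HiggsLattice.Site P 0)).card : ℝ) * 2 ^ P.d) ≤ 2 * 2 ^ P.d :=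
            mul_le_mul_of_nonneg_right hcard (by positivity)
          have h2 : 4 * ((({x, x.shift μ} : Finset (HiggsLattice.Site P 0)).card : ℝ) * 2 ^ P.d) ≤ 4 * (2 * 2 ^ P.d) :=
            mul_le_mul_of_nonneg_left h1 (by norm_num)
          exact mul_le_mul_of_nonneg_right (mul_le_mul_of_nonneg_right h2 (by positivity)) zero_le_one
      _ ≤ 4 * (2 * 2 ^ P.d) * ((Cγ + CT) * P.mesh K) * 1 * (Real.exp 3 * Real.exp (-((D + D₀ + D₁) / (4 * K₀ * (P.L : ℝ) ^ K)))) * M := by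
          have h2 : CT * P.mesh K ≤ (Cγ + CT) * P.mesh K := mul_le_mul_of_nonneg_right (by linarith) hmesh.le
          gcongr
      _ = 4 * (2 * 2 ^ P.d) * (Cγ + CT) * Real.exp 3 * P.mesh K * Real.exp (-((D + D₀ + D₁) / (4 * K₀ * (P.L : ℝ) ^ K))) * M := by ring

end Main

end Literature.MathematicalPhysics.QuantumFieldTheory.Balaban1983to89.B1Ineq226RegularRegion

end
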